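import Literature.NumberTheory.Sieve.AletheiaZomleferFukshanskyGarcia2020ApplicationsBrunSieveProofs
import Literature.NumberTheory.LFunctions.MertensFromChebyshev
import HarnessLib

/-!
# Rough composite values of a linear polynomial inside a polynomial system: sieve lemmas

Topic `Literature/NumberTheory/Sieve`, companion of `PolynomialValuesSieveSequence.lean` (the sifted
sequence `polyAPSeq F N q r` of the values `F(n)`, `n ≤ N`, `n ≡ r (mod q)`) and of
`AletheiaZomleferFukshanskyGarcia2020ApplicationsBrunSieveProofs.lean` (the upper-bound sieve for
the values of a product polynomial `F = ∏ⱼ gⱼ` on an INTERVAL, `PolyPrimeCountBrun.*`).  Everything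
here is PROVED and elementary given the tree's Fundamental Lemma; no definition and no named fact is
introduced.  The lemmas are the ingredients of the classical bound "the `n ≤ x` at which a linear
member `gᵢ = aX + b` of a polynomial system takes a ROUGH BUT COMPOSITE value while the other members
stay rough are `O_g(δ·x/(log x)^k)`" (window of the least prime factor `p₁ ∈ (x^{(1−2δ)/2}, x^{(1+δ)/2}]`,
one progression modulo each `p₁`, `k`-dimensional upper-bound sieve — Halberstam–Richert,
*Sieve Methods*, Thm 2.5 and Thm 5.3), kept general (sub-namespace `LinearRoughComposite`):

* `card_apIndex_coprime_le_of_fundamentalLemma` — the upper-bound sieve on ONE PROGRESSION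
  `n ≡ r (mod q)` for the values of any `F ∈ ℤ[X]` positive on `n ≥ 1` whose root density has
  sieve dimension `κ`: `#{n ∈ apIndex N q r : (F(n), P(z)) = 1} ≤ (1 + C)(N/q)·V(z) + z²` when no
  prime `< z` divides `q` (the case `q = 1` is `PolyPrimeCountBrun.card_coprime_le_of_fundamentalLemma`;
  the dimension-`2` progression version with explicit constants is `card_apIndex_coprime_le` of
  `PolynomialValuesSieveBounds.lean`).
* `card_filter_dvd_and_le` — for a prime `p ∤ a` the `n` with `p ∣ a n + b` form one class mod `p`.
* `card_rough_nonprime_le_sum` — the union bound over the least prime factor of a rough composite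
  value `a m + b`: such `m ≤ x` are counted by `∑_{L < p ≤ U} #{m ≤ x : p ∣ a m + b, (F(m), P(z)) = 1}`.
* `card_rough_le_card_shift` — splitting off `n ≤ n₀` and translating `n = m + n₀`.
* `exists_eval_comp_eq_linear` — a degree-one `f` with positive leading coefficient, translated,
  is `m ↦ a m + b` with `a, b ∈ ℕ`, `a, b ≥ 1`.
* `prod_one_sub_rootCount_le_mul_pow` — `∏_{p ≤ y}(1 − ω_f(p)/p) ≤ B·(e^{6/log 2} log 2/log y)^k`
  once the Bateman–Horn partial product at `y` is `≤ B` (Mertens,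
  `Lichtman2020.prod_primesLE_one_sub_inv_le`).
* `sum_inv_primes_balanced_le` — Mertens over the window of balanced primes:
  `∑_{x^{(1−2δ)/2} < p ≤ x^{(1+δ)/2}} 1/p ≤ 7δ + 100/log x` (`0 < δ ≤ 1/4`), from the tree's
  `MertensChebyshev.sum_inv_primes_window_le`.
* `eventually_rpow_le_mul_div_log_pow` — `A x^{7/8} ≤ c·x/(log x)^k` eventually.

## References

* H. Halberstam, H.-E. Richert, *Sieve Methods* (1974), Thm 2.5 (Fundamental Lemma), §1.4
  (polynomial sequences on a progression: Examples 3 and 5), Thm 5.3.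
-/

noncomputable section

open Filter Finset Polynomial Asymptotics

namespace Literature.NumberTheory.Sieve

namespace LinearRoughComposite

/-- **The upper-bound sieve on one progression** (Fundamental Lemma, level `D = z`, `s = 1`): if
`F(m) > 0` for `m ≥ 1`, the density `ω_F(m)/m` has dimension `κ` with constant `K`, `C` is the
constant of the uniform Fundamental Lemma for `(κ, K)` and no prime `< z` divides `q ≥ 1`, then
`#{1 ≤ m ≤ N : m ≡ r (q), (F(m), P(z)) = 1} ≤ (1 + C)(N/q)∏_{p<z}(1 − ω_F(p)/p) + z²` for `z ≥ 2`
(the remainder sum is `≤ ∑_{d ∣ P(z), d ≤ z} ω_F(d) ≤ z²`; Halberstam–Richert Thm 2.5 with §1.4,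
Example 5).  The case `q = 1` is `PolyPrimeCountBrun.card_coprime_le_of_fundamentalLemma`, whose
proof is copied. [folklore] -/
theorem card_apIndex_coprime_le_of_fundamentalLemma {κ K CFL : ℝ} (hCFL : 0 ≤ CFL)
    (hFL : ∀ A : SieveSequence, HasSieveDimension A.density κ K →
      ∀ x z D : ℝ, 2 ≤ z → z ≤ D → 0 ≤ A.size x →
        |A.sifted x (primesProdBelow z) - A.size x * A.densityProduct (primesProdBelow z)| ≤
          CFL * A.size x * A.densityProduct (primesProdBelow z) *
              Real.exp (-(Real.log D / Real.log z)) +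
            ∑ d ∈ (primesProdBelow z).divisors.filter (fun d : ℕ => (d : ℝ) ≤ D),
              |A.remainder d x|)
    {F : ℤ[X]} (hdim : HasSieveDimension (rootDensity F) κ K)
    (hFpos : ∀ m : ℕ, 0 < m → 0 < F.eval (m : ℤ)) (N : ℕ) {q : ℕ} (hq : 0 < q) (r : ℕ)
    {z : ℝ} (hz : 2 ≤ z) (hqz : ∀ p : ℕ, p.Prime → (p : ℝ) < z → ¬ p ∣ q) :
    (#((apIndex N q r).filter fun m : ℕ =>
        (F.eval (m : ℤ)).natAbs.Coprime (primesProdBelow z)) : ℝ) ≤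
      (1 + CFL) * ((N : ℝ) / q) *
          (∏ p ∈ Nat.primesBelow ⌈z⌉₊, (1 - (polyRootCountMod ![F] p : ℝ) / p)) + z ^ 2 := by
  set A := polyAPSeq F N q r with hA
  set x : ℝ := ∑ m ∈ Ioc 0 N, ((F.eval (m : ℤ) : ℤ) : ℝ) with hx
  have hxb : ∀ m ∈ apIndex N q r, 0 < F.eval (m : ℤ) ∧ ((F.eval (m : ℤ) : ℤ) : ℝ) ≤ x := by
    intro m hm
    have hm' : m ∈ Ioc 0 N := apIndex_subset N q r hm
    refine ⟨hFpos m (mem_Ioc.mp hm').1, ?_⟩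
    rw [hx]
    exact single_le_sum (f := fun m : ℕ => ((F.eval (m : ℤ) : ℤ) : ℝ)) (fun n hn => by
      rw [mem_Ioc] at hn
      exact_mod_cast (hFpos n hn.1).le) hm'
  have hdimA : HasSieveDimension A.density κ K := hdim
  have hX : 0 ≤ A.size x := by rw [hA, polyAPSeq_size]; positivity
  have h := hFL A hdimA x z z hz le_rfl hX
  rw [hA, polyAPSeq_sifted F N q r hxb, polyAPSeq_size, polyAPSeq_densityProduct] at h
  have hR := sum_abs_remainder_polyAPSeq_le F (N := N) (r := r) hq (z := z) (D := z) hqz hxb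
  have hz0 : 0 ≤ z := by linarith
  have hR2 : ∑ m ∈ (primesProdBelow z).divisors.filter (fun m : ℕ => (m : ℝ) ≤ z),
      (polyRootCountMod ![F] m : ℝ) ≤ z ^ 2 := by
    set W := (primesProdBelow z).divisors.filter (fun m : ℕ => (m : ℝ) ≤ z) with hW
    calc ∑ m ∈ W, (polyRootCountMod ![F] m : ℝ) ≤ ∑ m ∈ W, z := sum_le_sum fun m hm => by
          have h2 := (mem_filter.mp hm).2
          exact le_trans (by exact_mod_cast polyRootCountMod_le ![F] m) h2
      _ = #W * z := by rw [sum_const, nsmul_eq_mul]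
      _ ≤ z * z := by
          refine mul_le_mul_of_nonneg_right ?_ hz0
          calc (#W : ℝ) ≤ #(Icc 1 ⌊z⌋₊) := by
                exact_mod_cast card_le_card (fun m hm => by
                  rw [hW, mem_filter, Nat.mem_divisors] at hm
                  rw [mem_Icc]
                  exact ⟨Nat.pos_of_dvd_of_pos hm.1.1 (Nat.pos_of_ne_zero hm.1.2),
                    Nat.le_floor hm.2⟩)
            _ = ⌊z⌋₊ := by simp
            _ ≤ z := Nat.floor_le hz0
      _ = z ^ 2 := (sq z).symm
  have hexp : Real.exp (-(Real.log z / Real.log z)) ≤ 1 := by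
    rw [Real.exp_le_one_iff, neg_nonpos]
    exact div_nonneg (Real.log_nonneg (by linarith)) (Real.log_nonneg (by linarith))
  set V := ∏ p ∈ Nat.primesBelow ⌈z⌉₊, (1 - (polyRootCountMod ![F] p : ℝ) / p) with hV
  have hV0 : 0 ≤ V := prod_nonneg fun p _ => by
    have := rootDensity_le_one F p
    rw [rootDensity_apply] at this
    linarith
  have hNq : (0 : ℝ) ≤ (N : ℝ) / q := by positivity
  have hmain : CFL * ((N : ℝ) / q) * V * Real.exp (-(Real.log z / Real.log z)) ≤
      CFL * ((N : ℝ) / q) * V :=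
    mul_le_of_le_one_right (by positivity) hexp
  have hab := (abs_le.mp h).2
  linarith [hR.trans hR2]

/-- **One residue class per prime.** If `p` is a prime not dividing `a`, the `1 ≤ m ≤ x` with
`p ∣ a m + b` lie in a single class modulo `p`; so if every class count `#{m ∈ apIndex x p s : Q m}`
is at most `B ≥ 0`, then `#{1 ≤ m ≤ x : p ∣ a m + b, Q m} ≤ B`. [folklore] -/
theorem card_filter_dvd_and_le {a b p : ℕ} (hp : p.Prime) (hpa : ¬ p ∣ a) (x : ℕ)
    (Q : ℕ → Prop) [DecidablePred Q] {B : ℝ} (hB0 : 0 ≤ B)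
    (hB : ∀ s : ℕ, (#((apIndex x p s).filter fun m : ℕ => Q m) : ℝ) ≤ B) :
    (#((Ioc 0 x).filter fun m : ℕ => p ∣ a * m + b ∧ Q m) : ℝ) ≤ B := by
  set S := (Ioc 0 x).filter fun m : ℕ => p ∣ a * m + b ∧ Q m with hS
  rcases S.eq_empty_or_nonempty with h0 | ⟨m₀, hm₀⟩
  · rw [h0, card_empty, Nat.cast_zero]; exact hB0
  · refine le_trans ?_ (hB m₀)
    have hm₀' := hm₀
    rw [hS, mem_filter, mem_Ioc] at hm₀'
    exact_mod_cast card_le_card fun m hm => by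
      rw [hS, mem_filter, mem_Ioc] at hm
      rw [mem_filter, mem_apIndex]
      refine ⟨⟨hm.1, ?_⟩, hm.2.2⟩
      have h1 : a * m + b ≡ a * m₀ + b [MOD p] :=
        (Nat.modEq_zero_iff_dvd.mpr hm.2.1).trans (Nat.modEq_zero_iff_dvd.mpr hm₀'.2.1).symm
      have h2 : a * m ≡ a * m₀ [MOD p] := Nat.ModEq.add_right_cancel' b h1
      exact Nat.ModEq.cancel_left_of_coprime
        (Nat.Coprime.gcd_eq_one ((Nat.Prime.coprime_iff_not_dvd hp).mpr hpa)) h2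

/-- **The union bound over the least prime factor.**  Let `g₁, …, g_k ∈ ℤ[X]` with
`gᵢ(m) = a m + b` (`a, b ≥ 1`) and `F(m) = ∏ⱼ gⱼ(m)`; let `T₁, …, T_k` be roughness thresholds,
`L < Tᵢ`, `⌈z⌉₊ ≤ Tⱼ` for all `j`, and `a x + b < (U + 1)²`.  If `1 ≤ m ≤ x`, every `gⱼ(m)` is free
of primes `< Tⱼ` and `gᵢ(m)` is not prime, then `gᵢ(m) ≥ 2` is composite, `p := minFac gᵢ(m)` is a
prime with `Tᵢ ≤ p` (roughness) and `p² ≤ gᵢ(m) ≤ a x + b` (`Nat.minFac_sq_le_self`), so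
`L < p ≤ U`, `p ∣ a m + b`, and `F(m)` has no prime factor `< z`.  Hence the count of such `m` is
at most `∑_{L < p ≤ U prime} #{1 ≤ m ≤ x : p ∣ a m + b, (F(m), P(z)) = 1}`. [folklore] -/
theorem card_rough_nonprime_le_sum {k : ℕ} (g : Fin k → ℤ[X]) (i : Fin k) {a b : ℕ} (ha : 0 < a)
    (hb : 0 < b) (hgi : ∀ m : ℕ, (g i).eval (m : ℤ) = ((a * m + b : ℕ) : ℤ)) (F : ℤ[X])
    (hF : ∀ m : ℕ, F.eval (m : ℤ) = ∏ j, (g j).eval (m : ℤ)) (T : Fin k → ℕ) (x L U : ℕ)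
    (z : ℝ) (hL : L < T i) (hzT : ∀ j, ⌈z⌉₊ ≤ T j) (hU : a * x + b < (U + 1) ^ 2) :
    #((Ioc 0 x).filter fun m : ℕ =>
        (∀ j, ∀ p ∈ range (T j), p.Prime → ¬ ((p : ℤ) ∣ (g j).eval (m : ℤ))) ∧
          ¬ ((g i).eval (m : ℤ)).toNat.Prime) ≤
      ∑ p ∈ (Ioc L U).filter Nat.Prime,
        #((Ioc 0 x).filter fun m : ℕ =>
          p ∣ a * m + b ∧ (F.eval (m : ℤ)).natAbs.Coprime (primesProdBelow z)) := by
  classical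
  set PW := (Ioc L U).filter Nat.Prime with hPW
  set t : ℕ → Finset ℕ := fun p => (Ioc 0 x).filter fun m : ℕ =>
    p ∣ a * m + b ∧ (F.eval (m : ℤ)).natAbs.Coprime (primesProdBelow z) with ht
  refine le_trans (card_le_card ?_) (card_biUnion_le (s := PW) (t := t))
  intro m hm
  rw [mem_filter, mem_Ioc] at hm
  obtain ⟨⟨hm0, hmx⟩, hrough, hnp⟩ := hm
  rw [hgi, Int.toNat_natCast] at hnp
  set n : ℕ := a * m + b with hn
  have hn2 : 2 ≤ n := by rw [hn]; nlinarith
  set p := n.minFac with hp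
  have hpp : p.Prime := Nat.minFac_prime (by omega)
  have hpn : p ∣ n := Nat.minFac_dvd n
  have hp2 : p ^ 2 ≤ n := Nat.minFac_sq_le_self (by omega) hnp
  rw [mem_biUnion]
  refine ⟨p, ?_, ?_⟩
  · rw [hPW, mem_filter, mem_Ioc]
    refine ⟨⟨?_, ?_⟩, hpp⟩
    · by_contra hle
      push Not at hle
      refine hrough i p (mem_range.mpr (lt_of_le_of_lt hle hL)) hpp ?_
      rw [hgi]
      exact Int.natCast_dvd_natCast.mpr hpn
    · have h1 : p ^ 2 < (U + 1) ^ 2 := by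
        calc p ^ 2 ≤ n := hp2
          _ ≤ a * x + b := by rw [hn]; nlinarith
          _ < (U + 1) ^ 2 := hU
      have h2 : p < U + 1 := lt_of_pow_lt_pow_left₀ 2 (Nat.zero_le _) h1
      omega
  · rw [ht, mem_filter, mem_Ioc]
    refine ⟨⟨hm0, hmx⟩, hpn, ?_⟩
    rw [coprime_primesProdBelow_iff]
    intro q hq hqF
    rw [Nat.mem_primesBelow] at hq
    have hqZ : (q : ℤ) ∣ F.eval (m : ℤ) := Int.natCast_dvd.mpr hqF
    rw [hF] at hqZ
    obtain ⟨j, -, hj⟩ := (Prime.dvd_finsetProd_iff (Nat.prime_iff_prime_int.mp hq.2) _).mp hqZ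
    exact hrough j q (mem_range.mpr (lt_of_lt_of_le hq.1 (hzT j))) hq.2 hj

/-- **Splitting off `n ≤ n₀` and translating.**  For thresholds `Tⱼ` and every `n₀`,
`#{1 ≤ n ≤ x : every fⱼ(n) > 0 and free of primes < Tⱼ, fᵢ(n) not prime}
 ≤ (n₀ + 1) + #{1 ≤ m ≤ x : every fⱼ(m + n₀) free of primes < Tⱼ, fᵢ(m + n₀) not prime}`
(`n ↦ n − n₀`; the positivity clause is dropped). [folklore] -/
theorem card_rough_le_card_shift {k : ℕ} (f : Fin k → ℤ[X]) (i : Fin k) (T : Fin k → ℕ)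
    (x n₀ : ℕ) :
    #((Icc 1 x).filter fun n : ℕ => (∀ j, 0 < (f j).eval (n : ℤ) ∧
        ∀ p ∈ range (T j), p.Prime → ¬ ((p : ℤ) ∣ (f j).eval (n : ℤ))) ∧
          ¬ ((f i).eval (n : ℤ)).toNat.Prime) ≤
      (n₀ + 1) + #((Ioc 0 x).filter fun m : ℕ =>
        (∀ j, ∀ p ∈ range (T j), p.Prime →
            ¬ ((p : ℤ) ∣ ((f j).comp (X + C (n₀ : ℤ))).eval (m : ℤ))) ∧
          ¬ ((((f i).comp (X + C (n₀ : ℤ))).eval (m : ℤ)).toNat.Prime)) := by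
  classical
  set S := (Ioc 0 x).filter fun m : ℕ =>
      (∀ j, ∀ p ∈ range (T j), p.Prime →
          ¬ ((p : ℤ) ∣ ((f j).comp (X + C (n₀ : ℤ))).eval (m : ℤ))) ∧
        ¬ ((((f i).comp (X + C (n₀ : ℤ))).eval (m : ℤ)).toNat.Prime) with hS
  have hev : ∀ j (m : ℕ), ((f j).comp (X + C (n₀ : ℤ))).eval (m : ℤ) =
      (f j).eval (((m + n₀ : ℕ) : ℤ)) := fun j m => by
    simp [eval_comp]
  refine (card_le_card (t := range (n₀ + 1) ∪ S.image (· + n₀)) ?_).trans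
    ((card_union_le _ _).trans ?_)
  swap
  · rw [card_range]; exact Nat.add_le_add_left card_image_le _
  intro n hn
  simp only [mem_filter, mem_Icc] at hn
  obtain ⟨⟨-, hnx⟩, hall, hnp⟩ := hn
  rw [mem_union, mem_range, mem_image]
  by_cases hnn : n < n₀ + 1
  · exact Or.inl hnn
  · right
    refine ⟨n - n₀, ?_, by omega⟩
    have hsub : n - n₀ + n₀ = n := by omega
    rw [hS, mem_filter, mem_Ioc]
    refine ⟨⟨by omega, by omega⟩, fun j p hp hpp => ?_, ?_⟩
    · rw [hev, hsub]
      exact (hall j).2 p hp hpp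
    · rw [hev, hsub]
      exact hnp

/-- **A translated linear polynomial.**  If `deg f = 1`, `f` has positive leading coefficient and
`f(n₀) ≥ 1`, then `f(m + n₀) = a m + b` for all `m ∈ ℕ` with natural numbers `a, b ≥ 1`
(`a` the leading coefficient, `b = f(n₀)`). [folklore] -/
theorem exists_eval_comp_eq_linear {f : ℤ[X]} (hdeg : f.natDegree = 1) (hlc : 0 < f.leadingCoeff)
    (n₀ : ℕ) (hpos : 1 ≤ (f.comp (X + C (n₀ : ℤ))).eval ((0 : ℕ) : ℤ)) :
    ∃ a b : ℕ, 0 < a ∧ 0 < b ∧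
      ∀ m : ℕ, (f.comp (X + C (n₀ : ℤ))).eval (m : ℤ) = ((a * m + b : ℕ) : ℤ) := by
  have hfi := eq_X_add_C_of_natDegree_le_one (le_of_eq hdeg)
  have hfe : ∀ t : ℤ, f.eval t = f.coeff 1 * t + f.coeff 0 := fun t => by
    conv_lhs => rw [hfi]
    simp only [eval_add, eval_mul, eval_C, eval_X]
  have hα0 : 0 < f.coeff 1 := by rwa [leadingCoeff, hdeg] at hlc
  have hge : ∀ m : ℕ, (f.comp (X + C (n₀ : ℤ))).eval (m : ℤ) =
      f.coeff 1 * m + (f.coeff 1 * n₀ + f.coeff 0) := fun m => by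
    rw [eval_comp, eval_add, eval_X, eval_C, hfe]; ring
  have hβ1 : 1 ≤ f.coeff 1 * n₀ + f.coeff 0 := by
    have := hpos; rw [hge] at this; simpa using this
  refine ⟨(f.coeff 1).toNat, (f.coeff 1 * n₀ + f.coeff 0).toNat, by omega, by omega, fun m => ?_⟩
  rw [hge]; push_cast
  rw [Int.toNat_of_nonneg hα0.le, Int.toNat_of_nonneg (by omega)]

/-- **The sieve product against the Bateman–Horn partial product.**  If `ω_F = ω_f` and the
Bateman–Horn partial product of `f` at `y ≥ 2` is `≤ B` (`B ≥ 0`), then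
`∏_{p ≤ y}(1 − ω_F(p)/p) ≤ B·(e^{6/log 2} log 2/log y)^k`
(`PolyPrimeCountBrun.prod_one_sub_rootCount_eq` and Mertens,
`Lichtman2020.prod_primesLE_one_sub_inv_le`). [folklore] -/
theorem prod_one_sub_rootCount_le_mul_pow {k : ℕ} (f : Fin k → ℤ[X]) {F : ℤ[X]}
    (hρF : ∀ p, polyRootCountMod ![F] p = polyRootCountMod f p) {y : ℕ} (hy : 2 ≤ y) {B : ℝ}
    (hB0 : 0 ≤ B) (hB : batemanHornPartial f y ≤ B) :
    ∏ p ∈ Nat.primesBelow ⌈((y + 1 : ℕ) : ℝ)⌉₊, (1 - (polyRootCountMod ![F] p : ℝ) / p) ≤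
      B * (Real.exp (6 / Real.log 2) * Real.log 2 / Real.log y) ^ k := by
  set M : ℝ := ∏ p ∈ Nat.primesLE y, (1 - 1 / (p : ℝ)) with hM
  have hM0 : 0 ≤ M := prod_nonneg fun p hp => by
    have : (2 : ℝ) ≤ p := by exact_mod_cast (Nat.prime_of_mem_primesLE hp).two_le
    have : (1 : ℝ) / p ≤ 1 / 2 := one_div_le_one_div_of_le (by norm_num) this
    linarith
  have hMle : M ≤ Real.exp (6 / Real.log 2) * Real.log 2 / Real.log y := by
    rw [mul_div_assoc]; exact Lichtman2020.prod_primesLE_one_sub_inv_le hy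
  have hVeq : ∏ p ∈ Nat.primesBelow ⌈((y + 1 : ℕ) : ℝ)⌉₊, (1 - (polyRootCountMod ![F] p : ℝ) / p) =
      batemanHornPartial f y * M ^ k := by
    rw [Nat.ceil_natCast]
    change ∏ p ∈ Nat.primesLE y, (1 - (polyRootCountMod ![F] p : ℝ) / p) = _
    simp_rw [hρF]
    exact PolyPrimeCountBrun.prod_one_sub_rootCount_eq f y
  rw [hVeq]
  exact mul_le_mul hB (pow_le_pow_left₀ hM0 hMle k) (pow_nonneg hM0 k) hB0

/-- **Mertens over the window of balanced primes**: for `0 < δ ≤ 1/4`, `x > 1` and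
`x^{(1−2δ)/2} ≥ e^{10}`,
`∑_{x^{(1−2δ)/2} < p ≤ x^{(1+δ)/2}} 1/p ≤ 1.0722·log((1+δ)/(1−2δ)) + 0.133/log x^{(1−2δ)/2} + 12/x^{(1−2δ)/4}
≤ 7δ + 100/log x` (`MertensChebyshev.sum_inv_primes_window_le`; `log((1+δ)/(1−2δ)) ≤ 3δ/(1−2δ) ≤ 6δ`,
`log t ≤ 2√t`). [folklore] -/
theorem sum_inv_primes_balanced_le {δ : ℝ} (hδ0 : 0 < δ) (hδ : δ ≤ 1 / 4) {x : ℝ} (hx1 : 1 < x)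
    (hx : Real.exp 10 ≤ x ^ ((1 - 2 * δ) / 2)) :
    ∑ p ∈ (Ioc ⌊x ^ ((1 - 2 * δ) / 2)⌋₊ ⌊x ^ ((1 + δ) / 2)⌋₊).filter Nat.Prime, (1 : ℝ) / p ≤
      7 * δ + 100 / Real.log x := by
  set y : ℝ := x ^ ((1 - 2 * δ) / 2) with hy
  set u : ℝ := x ^ ((1 + δ) / 2) with hu
  have hx0 : 0 < x := by linarith
  have hlogx : 0 < Real.log x := Real.log_pos hx1
  have hyu : y ≤ u := Real.rpow_le_rpow_of_exponent_le hx1.le (by linarith)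
  have h := Literature.NumberTheory.LFunctions.MertensChebyshev.sum_inv_primes_window_le hx hyu
  have hlogy : Real.log y = (1 - 2 * δ) / 2 * Real.log x := by rw [hy, Real.log_rpow hx0]
  have hlogu : Real.log u = (1 + δ) / 2 * Real.log x := by rw [hu, Real.log_rpow hx0]
  have h1δ : (0 : ℝ) < 1 + δ := by linarith
  have h2δ : (1 : ℝ) / 2 ≤ 1 - 2 * δ := by linarith
  have h2δ0 : (0 : ℝ) < 1 - 2 * δ := by linarith
  have hy0 : 0 < y := by rw [hy]; exact Real.rpow_pos_of_pos hx0 _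
  have hlogy_pos : 0 < Real.log y := by rw [hlogy]; exact mul_pos (by linarith) hlogx
  have hratio : Real.log (Real.log u) - Real.log (Real.log y) =
      Real.log ((1 + δ) / (1 - 2 * δ)) := by
    rw [hlogu, hlogy, Real.log_mul (by positivity) hlogx.ne',
      Real.log_mul (div_pos h2δ0 two_pos).ne' hlogx.ne', Real.log_div h1δ.ne' h2δ0.ne',
      Real.log_div h1δ.ne' two_ne_zero, Real.log_div h2δ0.ne' two_ne_zero]
    ring
  have hlog_le : Real.log ((1 + δ) / (1 - 2 * δ)) ≤ 6 * δ := by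
    have h1 := Real.log_le_sub_one_of_pos (div_pos h1δ h2δ0)
    have h2 : (1 + δ) / (1 - 2 * δ) - 1 ≤ 6 * δ := by
      rw [sub_le_iff_le_add, div_le_iff₀ h2δ0]
      nlinarith only [hδ0, hδ]
    linarith only [h1, h2]
  have hylog : Real.log x / 4 ≤ Real.log y := by rw [hlogy]; nlinarith only [h2δ, hlogx]
  have he1 : 0.133 / Real.log y ≤ 1 / Real.log x := by
    rw [div_le_div_iff₀ hlogy_pos hlogx]; nlinarith only [hylog, hlogx]
  have hsqrt_pos : 0 < Real.sqrt y := Real.sqrt_pos.mpr hy0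
  have he2 : 12 / Real.sqrt y ≤ 96 / Real.log x := by
    have hs : Real.log (Real.sqrt y) = Real.log y / 2 := Real.log_sqrt hy0.le
    have hs2 := Real.log_le_sub_one_of_pos hsqrt_pos
    rw [div_le_div_iff₀ hsqrt_pos hlogx]
    nlinarith only [hs, hs2, hylog, hlogx, hsqrt_pos]
  have he3 : 1 / Real.log x + 96 / Real.log x ≤ 100 / Real.log x := by
    rw [← add_div]; exact div_le_div_of_nonneg_right (by norm_num) hlogx.le
  calc _ ≤ 1.0722 * (Real.log (Real.log u) - Real.log (Real.log y)) + 0.133 / Real.log y +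
        12 / Real.sqrt y := h
    _ ≤ 1.0722 * (6 * δ) + 1 / Real.log x + 96 / Real.log x := by
        rw [hratio]
        have := mul_le_mul_of_nonneg_left hlog_le (by norm_num : (0 : ℝ) ≤ 1.0722)
        linarith
    _ ≤ 7 * δ + 100 / Real.log x := by linarith only [he1, he2, he3, hδ0]

/-- `A·x^{7/8} ≤ c·x/(log x)^k` eventually in `x : ℕ`, for `A, c > 0`
(`(log x)^k = o(x^{1/8})`, `isLittleO_log_rpow_rpow_atTop`). [folklore] -/
theorem eventually_rpow_le_mul_div_log_pow (k : ℕ) {A c : ℝ} (hA : 0 < A) (hc : 0 < c) :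
    ∀ᶠ x : ℕ in atTop, A * (x : ℝ) ^ (7 / 8 : ℝ) ≤ c * ((x : ℝ) / Real.log x ^ k) := by
  have hlo := isLittleO_log_rpow_rpow_atTop (k : ℝ) (by norm_num : (0 : ℝ) < 1 / 8)
  have hev := hlo.def (div_pos hc hA)
  have hreal : ∀ᶠ x : ℝ in atTop, A * x ^ (7 / 8 : ℝ) ≤ c * (x / Real.log x ^ k) := by
    filter_upwards [hev, eventually_gt_atTop (1 : ℝ)] with x hx hx1
    have hx0 : 0 < x := by linarith
    have hlog : 0 < Real.log x := Real.log_pos hx1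
    rw [Real.norm_of_nonneg (Real.rpow_nonneg hlog.le _),
      Real.norm_of_nonneg (Real.rpow_nonneg hx0.le _), Real.rpow_natCast] at hx
    have hsplit : x ^ (7 / 8 : ℝ) * x ^ (1 / 8 : ℝ) = x := by
      rw [← Real.rpow_add hx0]; norm_num
    rw [mul_div_assoc', le_div_iff₀ (pow_pos hlog k)]
    have h1 : A * Real.log x ^ k ≤ c * x ^ (1 / 8 : ℝ) := by
      have := mul_le_mul_of_nonneg_left hx hA.le
      have e : A * (c / A * x ^ (1 / 8 : ℝ)) = c * x ^ (1 / 8 : ℝ) := by field_simp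
      linarith
    calc A * x ^ (7 / 8 : ℝ) * Real.log x ^ k = x ^ (7 / 8 : ℝ) * (A * Real.log x ^ k) := by ring
      _ ≤ x ^ (7 / 8 : ℝ) * (c * x ^ (1 / 8 : ℝ)) :=
          mul_le_mul_of_nonneg_left h1 (Real.rpow_nonneg hx0.le _)
      _ = c * x := by rw [← mul_assoc, mul_comm _ c, mul_assoc, hsplit]
  exact tendsto_natCast_atTop_atTop.eventually hreal

end LinearRoughComposite

end Literature.NumberTheory.Sieve
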